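import Literature.NumberTheory.CubicFields.StabilizerFiniteReducible
import Literature.NumberTheory.CubicFields.ShintaniZeta
import HarnessLib

/-!
# `|Stab(f)| ≤ 12` for every nondegenerate binary cubic form

Topic `Literature/NumberTheory/CubicFields`; a quantitative form of `StabilizerFiniteReducible.lean`
(finiteness of `Stab_{GL₂(ℤ)}(f)` for reducible nondegenerate `f`) and `StabilizerFinite.lean`
(`|Stab(f)| ≤ 3` for irreducible `f`). Bhargava–Taniguchi–Thorne 2023, §2.4 (11): Shintani's zeta
functions weight each nondegenerate orbit by `|Stab(x)|⁻¹`; to pass from the weighted counts `N^±(X, Φ_m)`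
of Theorem 3.1/3.2 to plain orbit counts (as in the proof of Prop. 5.1, `N > Q^{100}`, via Prop. 4.7) one
needs a uniform upper bound for `|Stab(x)|`. This file PROVES:

* `ncard_firstRows_le` — for `b ≠ 0` the admissible first rows of `Stab(0, b, c, d)` (primitive `(p, q)` with
  `q (bp² + cpq + dq²) = 0`) number at most `6`: `(±1, 0)` and at most two primitive vectors on each of the
  `≤ 2` rational root lines of `bt² + ct + d`;
* `card_stabilizer_le_of_a_eq_zero` — `|Stab(0, b, c, d)| ≤ 12` (an element is determined by its first row
  and its determinant, `eq_of_mem_stabilizer_of_row_eq`);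
* **`card_stabilizer_le_twelve`, `stabCard_le_twelve`** — `|Stab(f)| ≤ 12` whenever `Disc f ≠ 0`
  (irreducible: `≤ 3`; reducible: `GL₂(ℤ)`-equivalent to some `(0, b, c, d)`, `b ≠ 0`).

(The sharp bound is `6 = |S₃|`, the automorphisms of the étale algebra `ℚ³`; `12` suffices for all uses.)

## References

* M. Bhargava, T. Taniguchi, F. Thorne, *Improved error estimates for the Davenport–Heilbronn
  theorems*, Math. Ann. 389 (2024) = arXiv:2107.12819, §2.4 (11) [BhargavaTaniguchiThorne2023].
-/

namespace Literature.NumberTheory.CubicFields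

open BinaryCubic Polynomial

/-- **At most `6` admissible first rows** for `Stab(0, b, c, d)`, `b ≠ 0`. [folklore] -/
theorem ncard_firstRows_le {b : ℤ} (hb : b ≠ 0) (c d : ℤ) : (firstRows b c d).ncard ≤ 6 := by
  classical
  -- the rational quadratic and its at most two roots
  set P : ℚ[X] := C (b : ℚ) * X ^ 2 + C (c : ℚ) * X + C (d : ℚ) with hP
  have hP0 : P ≠ 0 := by
    intro h
    have := congrArg (fun R : ℚ[X] => R.coeff 2) h
    simp only [hP, coeff_add, coeff_C_mul, coeff_X_pow, coeff_X, coeff_C, coeff_zero] at this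
    norm_num at this
    exact hb (by exact_mod_cast this)
  have hdeg : P.natDegree ≤ 2 := by
    rw [hP]
    exact natDegree_quadratic_le
  have hroots : P.roots.toFinset.card ≤ 2 :=
    (Multiset.toFinset_card_le _).trans ((Polynomial.card_roots' P).trans hdeg)
  -- split off `q = 0` (then `p = ±1`)
  set B : Set (ℤ × ℤ) := {v | v ∈ firstRows b c d ∧ v.2 ≠ 0} with hBdef
  have hBfin : B.Finite := (firstRows_finite hb c d).subset fun v hv => hv.1
  have hsub : firstRows b c d ⊆ {(1, 0), (-1, 0)} ∪ B := by
    intro v hv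
    by_cases hq : v.2 = 0
    · left
      have hu : IsUnit v.1 := by
        have hcop := hv.2
        rw [hq] at hcop
        exact isCoprime_zero_right.mp hcop
      rcases Int.isUnit_iff.mp hu with h1 | h1
      · left; exact Prod.ext h1 hq
      · right; exact Prod.ext h1 hq
    · right; exact ⟨hv, hq⟩
  -- `B` injects into `roots(P) × Bool` by `v ↦ (p/q, [0 < q])`
  let Φ : ℤ × ℤ → ℚ × Bool := fun v => ((v.1 : ℚ) / v.2, decide (0 < v.2))
  have hmaps : Φ '' B ⊆ ↑(P.roots.toFinset ×ˢ (Finset.univ : Finset Bool)) := by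
    rintro _ ⟨v, ⟨⟨hz, -⟩, hq⟩, rfl⟩
    rw [Finset.coe_product]
    refine ⟨?_, by simp⟩
    simp only [Finset.mem_coe, Multiset.mem_toFinset]
    rw [mem_roots hP0, IsRoot.def]
    have hQ : b * v.1 ^ 2 + c * v.1 * v.2 + d * v.2 ^ 2 = 0 := (mul_eq_zero.mp hz).resolve_left hq
    have hq' : (v.2 : ℚ) ≠ 0 := by exact_mod_cast hq
    have hQ' : (b : ℚ) * v.1 ^ 2 + c * v.1 * v.2 + d * v.2 ^ 2 = 0 := by exact_mod_cast hQ
    simp only [hP, eval_add, eval_mul, eval_C, eval_pow, eval_X]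
    have : (b : ℚ) * ((v.1 : ℚ) / v.2) ^ 2 + c * ((v.1 : ℚ) / v.2) + d =
        ((b : ℚ) * v.1 ^ 2 + c * v.1 * v.2 + d * v.2 ^ 2) / (v.2 : ℚ) ^ 2 := by
      field_simp
    rw [this, hQ', zero_div]
  have hinj : Set.InjOn Φ B := by
    rintro v ⟨⟨-, hvcop⟩, hvq⟩ w ⟨⟨-, hwcop⟩, hwq⟩ hvw
    simp only [Φ, Prod.mk.injEq, decide_eq_decide] at hvw
    obtain ⟨hslope, hsign⟩ := hvw
    rcases lt_or_gt_of_ne hvq with hvneg | hvpos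
    · have hwneg : w.2 < 0 := by
        have h1 : ¬ (0 < w.2) := fun h => absurd (hsign.mpr h) (by omega)
        omega
      obtain ⟨hn, hd⟩ := eq_num_den_of_isCoprime (neg_pos.mpr hvneg) hvcop.neg_neg
      obtain ⟨hn', hd'⟩ := eq_num_den_of_isCoprime (neg_pos.mpr hwneg) hwcop.neg_neg
      have hs : (((-v.1 : ℤ) : ℚ) / ((-v.2 : ℤ) : ℚ)) = (((-w.1 : ℤ) : ℚ) / ((-w.2 : ℤ) : ℚ)) := by
        push_cast
        rw [neg_div_neg_eq, neg_div_neg_eq]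
        exact hslope
      rw [hs] at hn hd
      apply Prod.ext
      · linarith [hn.symm.trans hn']
      · linarith [hd.symm.trans hd']
    · have hwpos : 0 < w.2 := hsign.mp hvpos
      obtain ⟨hn, hd⟩ := eq_num_den_of_isCoprime hvpos hvcop
      obtain ⟨hn', hd'⟩ := eq_num_den_of_isCoprime hwpos hwcop
      rw [hslope] at hn hd
      exact Prod.ext (hn.symm.trans hn') (hd.symm.trans hd')
  have hB : B.ncard ≤ 4 := by
    calc B.ncard = (Φ '' B).ncard := (hinj.ncard_image).symm
      _ ≤ (↑(P.roots.toFinset ×ˢ (Finset.univ : Finset Bool)) : Set (ℚ × Bool)).ncard :=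
          Set.ncard_le_ncard hmaps (Finset.finite_toSet _)
      _ = (P.roots.toFinset ×ˢ (Finset.univ : Finset Bool)).card := Set.ncard_coe_finset _
      _ ≤ 4 := by
          rw [Finset.card_product, Finset.card_univ, Fintype.card_bool]
          omega
  have hpair : ({(1, 0), (-1, 0)} : Set (ℤ × ℤ)).ncard ≤ 2 :=
    (Set.ncard_insert_le _ _).trans (by rw [Set.ncard_singleton])
  calc (firstRows b c d).ncard ≤ (({(1, 0), (-1, 0)} : Set (ℤ × ℤ)) ∪ B).ncard :=
        Set.ncard_le_ncard hsub (Set.Finite.union (Set.toFinite _) hBfin)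
    _ ≤ ({(1, 0), (-1, 0)} : Set (ℤ × ℤ)).ncard + B.ncard := Set.ncard_union_le _ _
    _ ≤ 2 + 4 := add_le_add hpair hB

/-- **`|Stab(0, b, c, d)| ≤ 12` for `b ≠ 0`**: the stabilizer injects into `firstRows × {±1}`. [folklore] -/
theorem card_stabilizer_le_of_a_eq_zero {b : ℤ} (hb : b ≠ 0) (c d : ℤ) :
    Nat.card (MulAction.stabilizer (GL (Fin 2) ℤ) (⟨0, b, c, d⟩ : BinaryCubic ℤ)) ≤ 12 := by
  haveI : Finite (firstRows b c d) := (firstRows_finite hb c d).to_subtype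
  have hinj : Function.Injective
      (fun γ : MulAction.stabilizer (GL (Fin 2) ℤ) (⟨0, b, c, d⟩ : BinaryCubic ℤ) =>
        ((⟨(((γ : GL (Fin 2) ℤ) : Matrix (Fin 2) (Fin 2) ℤ) 0 0, ((γ : GL (Fin 2) ℤ) : Matrix (Fin 2) (Fin 2) ℤ) 0 1),
            (row_constraint_of_mem_stabilizer γ.2)⟩ : firstRows b c d),
          decide ((((γ : GL (Fin 2) ℤ) : Matrix (Fin 2) (Fin 2) ℤ)).det = 1))) := by
    rintro ⟨γ, hγ⟩ ⟨γ', hγ'⟩ h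
    simp only [Prod.mk.injEq, Subtype.mk.injEq, decide_eq_decide] at h
    obtain ⟨⟨h00, h01⟩, hdet⟩ := h
    have hd : ((γ : Matrix (Fin 2) (Fin 2) ℤ)).det = ((γ' : Matrix (Fin 2) (Fin 2) ℤ)).det := by
      rcases Int.isUnit_iff.mp (Matrix.isUnits_det_units γ) with h1 | h1 <;>
        rcases Int.isUnit_iff.mp (Matrix.isUnits_det_units γ') with h2 | h2
      · rw [h1, h2]
      · exact absurd (hdet.mp h1) (by rw [h2]; norm_num)
      · exact absurd (hdet.mpr h2) (by rw [h1]; norm_num)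
      · rw [h1, h2]
    exact Subtype.ext (eq_of_mem_stabilizer_of_row_eq hb hγ hγ' h00 h01 hd)
  calc Nat.card (MulAction.stabilizer (GL (Fin 2) ℤ) (⟨0, b, c, d⟩ : BinaryCubic ℤ))
      ≤ Nat.card (firstRows b c d × Bool) := Nat.card_le_card_of_injective _ hinj
    _ = Nat.card (firstRows b c d) * 2 := by rw [Nat.card_prod, Nat.card_eq_fintype_card (α := Bool), Fintype.card_bool]
    _ ≤ 6 * 2 := Nat.mul_le_mul_right 2 (by rw [Nat.card_coe_set_eq]; exact ncard_firstRows_le hb c d)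

/-- **`|Stab(f)| ≤ 12` for every `f` with `Disc f ≠ 0`** (irreducible: `≤ 3`; reducible: conjugate to the
stabilizer of some `(0, b, c, d)` with `b ≠ 0`). [folklore] -/
theorem card_stabilizer_le_twelve {f : BinaryCubic ℤ} (h0 : f.disc ≠ 0) :
    Nat.card (MulAction.stabilizer (GL (Fin 2) ℤ) f) ≤ 12 := by
  by_cases hf : f.IsIrreducible
  · haveI : Fact f.IsIrreducible := ⟨hf⟩
    exact card_stabilizer_le_three.trans (by norm_num)
  obtain ⟨g, hfg, hga⟩ := exists_gl2zEquiv_a_eq_zero hf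
  have hdisc : g.disc = f.disc := hfg.disc_eq
  obtain ⟨γ, hγu, rfl⟩ := hfg
  set u : GL (Fin 2) ℤ := ((Matrix.isUnit_iff_isUnit_det γ).mpr hγu).unit with hu
  have hcoe : (u : Matrix (Fin 2) (Fin 2) ℤ) = γ := IsUnit.unit_spec _
  have hsmul : twist γ f = u • f := by rw [gl_smul_def, hcoe]
  rcases hg : twist γ f with ⟨a', b', c', d'⟩
  rw [hg] at hga hdisc hsmul
  simp only at hga
  subst hga
  have hb' : b' ≠ 0 := by
    intro hb0
    rw [hb0, disc_of_a_eq_zero] at hdisc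
    exact h0 (by rw [← hdisc]; ring)
  rw [Nat.card_congr (MulAction.stabilizerEquivStabilizer hsmul).toEquiv]
  exact card_stabilizer_le_of_a_eq_zero hb' c' d'

/-- **`|Stab(f)| ≤ 12`** in terms of `stabCard`. [folklore] -/
theorem stabCard_le_twelve {f : BinaryCubic ℤ} (h0 : f.disc ≠ 0) : stabCard f ≤ 12 :=
  card_stabilizer_le_twelve h0

end Literature.NumberTheory.CubicFields
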